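import Summits.QuantumFields.YangMills.Theorems.BalabanUVNodesN20KeyedRelWeightAtKeyReading
import Summits.QuantumFields.YangMills.Theorems.BalabanUVNodesN20KeyedRelWeightLevelsLive
import Literature.MathematicalPhysics.QuantumFieldTheory.Balaban1983to89.Node00.TwoRunSiteComponents

/-!
# BalabanUVNodes ∕ N20 (NE7b) — THE N20 FACE AT THE COMPONENT-FORGIVING KEY (dag-n20-d's `Node00/TwoRunSiteComponents.forgiveKeyCompSigma`, the dial value that DOES merge
# old structure): the survival socket at ANY step-preserving dial, and AT THE FORGIVING READING what the weight face books («an UN-ABSORBED birth in the window»), why the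
# policy wall of the full key ∕ level window does NOT transfer (a floor-saturated history is never booked), and the design rule there

Cell `pub-ymgap` (HUMAN RULING D-0062 Track A; work-bound push D-0149, director-ym №197), width seat `pub-ymgap-dag-n20-w2` (gen 3) on node N20 = NE7b; CLAIM-4 of the re-seat = trigger
(t4) of this lineage («when a REGION-relative ∕ forgiving key reading is typed, instantiate the N20 face there»), fired by dag-n20-d g29's `Node00/TwoRunSiteComponents.lean` (typed on
this seat's LOCATED «the level window merges no old structure», pub-ymgap INBOX l.31349 ∕ n20-d WORDS l.≈31377).  Filed `--kind proof --supports stmt-QuantumFields-20544 --as helper`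
(K3⁷ `SpineGivenEndpointR13SepCoPH`; skeleton v5 941dddb108cbaacf STANDS — no v6 text assumed); COUNT-NEUTRAL; LOCATED.
[III] = [Balaban1988Convergent], [LF-I] = [Balaban1989LargeFieldI], [LF-II] = [Balaban1989LargeFieldII].

WHY.  At every key typed before today the N20 weight face of stub 2 is idle cofinitely under the census's first-level saturation: at the FULL-history pin (dag-n20-w1
`…PolicyWall` p597932: cut `= 0` eventually; this seat's `…LevelsLive` v1.1 §5 in the survival currency) and at the LEVEL-window dial (this seat's `…AtKeyReading` §4: cut `≤` floor
eventually — the (2.1) chain is cumulative, the level window merges no old structure).  dag-n20-d's COMPONENT-WISE FORGIVING WINDOW `forgiveKeyComp F c` fills, above the floor `c`,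
every connected component of the large-field region `Z_j` that MEETS the floor region `Z_c` (old components together with whatever merged into them — (1.85)'s merging, [LF-II]
p.386), so that «old-bad at cut `jcut`» ⟺ «an UN-ABSORBED birth at a level in `(c, jcut]`» (`keyOldLargeField_forgiveKeyComp_iff`) and a history whose floor-level region is
everything (`Λ_c = ∅` — the saturated extreme) reads to the all-small key (`not_keyOldLargeField_forgiveKeyComp_of_floor_empty`).  THERE the wall's mechanism is gone: the
level-one class is no longer inside the coarse persistence class (§2 `forgive_not_mem_badClassK₁₃_of_floor_saturated`), and the weight face has a home — it books the histories
with an un-absorbed birth in the window (§2 `forgive_mem_badClassK₁₃_cut_iff_unabsorbed`), priced by the per-birth-level sockets of this lineage at the coarse carriers (§1, dial-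
generic; p610465 §2–§3) — the first typed reading at which the survival letter is not excluded by saturation.  Whether it HOLDS there is NE7b-at-the-window (entropy over the
window's levels only, [III] p.244 «a small fraction of the number K») — a HYPOTHESIS, NAMED OPEN.
CONTENTS (theorems only; 0 `def`):
* §1 (ANY step-preserving dial, n20-d's level-cut bad reading) ★★ `W_crOfRecord₁₃KAt_le_survival` (per-stratum survival domination at the COARSE carriers, cut inside the window ⇒
  `W K ≤ V·r^{K₀+K−jcut K}∕(1−r)`) · ★★ `relWeightBound_crOfRecord₁₃KAt_of_survival_ageFloor` (the design rule at a dial: rate `r`, entropy `V`, minimal age `a₀` with `V·r^{a₀} < 1−r`,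
  linear age floor ⇒ the face AT the dial reading);
* §2 (THE FORGIVING READING `kr := forgiveKeyCompSigma F c` at the tuple) `forgiveKeyCompSigma_fst_eq` (step-preserving) · `badClassK₁₃_forgive_cut_eq_empty_at` (cut `≤` floor at `K` ⇒
  `∅`) · ★ `forgive_not_mem_badClassK₁₃_of_floor_saturated` (a class key with `Λ_{c K} = ∅` is NEVER booked, any cut — contrast `…AtKeyReading.windowKeySigma_mem_badClassK₁₃_of_levelOne`)
  · ★ `forgive_mem_badClassK₁₃_cut_iff_unabsorbed` (WHAT THE FACE BOOKS: an un-absorbed birth at a level in `(c K, jcut K]`) · `relWeightBound_crOfRecord₁₃KAt_forgive_iff` (canonical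
  form there) · ★★ `relWeightBound_crOfRecord₁₃KAt_forgive_of_survival_ageFloor` (the design rule AT the forgiving reading with a floor reading `cR` and a cut `jcut`).
Cited BY NAME, not re-typed: dag-n20-d `Node00/TwoRunSiteComponents` (`forgiveKeyCompSigma`, `_fst`, `_mk`, `keyOldLargeField_forgiveKeyComp_iff`, `not_keyOldLargeField_forgiveKeyCompSigma_of_floor_empty`,
`keyOldLargeField_of_forgiveKeyComp`), `…SpineReadingOfRecord13CoPHK` (`crOfRecord₁₃KAt`, `classSetK₁₃`, `badClassK₁₃`, `kr_mem_classSetK₁₃`, `mem_badClassK₁₃_iff`), this seat's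
`…AtKeyReading` (§1 iff, §2 `mem_badClassK₁₃_cut_iff`, §3 `W_crOfRecord₁₃KAt_le_sum_levels`), `…Levels` §1 (`sum_range_pow_age_le`, `summable_ageMajorant_of_linearAge`), `…LevelsLive` §4
(`survivalMajorant_lt_one_of_ageFloor`), dag-n20-w1 `…OverCut` (`fst_eq_of_mem_classSet₁₃`).

HONEST FRAMING.  [folklore] finite-sum ∕ set bookkeeping BY NAME over n20-d's readings; the survival letter is a HYPOTHESIS (NE7b's body at the window key, NAMED OPEN — here merely
NOT EXCLUDED by first-level saturation, nothing more is claimed); NO weight bounded, NO estimate proved.  The forgiving window is NOT Bałaban's (1.80): `K(Z)` is size-dependent and 𝐑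
needs (i),(ii) — it forgives EVERY floor-old component regardless of size (n20-d's header); (AC)'s over-age booking of huge pending regions would sit on top as a further bad-key reading.
Nothing of Bałaban's is asserted; NE7 ∕ NE7b ∕ NE7c NOT PRINTED for `d = 4`, NOT proved; (α)-instance 0∕1; no `Provisos₁₃CoPH` inhabitant claimed (K0⁷ OPEN); N19 ∕ N20 ∕ N21 ∕ N27 NOT
discharged; K3⁷ NOT closed (v5 stands; no dial is pinned by any registered text); counts unmoved (typed 28∕28 · discharged 5∕27); no count claim (the chair's single count line is the only
count).  One finite `𝕋⁴_{L^K}` programme at fixed `ε = L^{−K}`, Bałaban AS PRINTED; the YM mass gap (Clay) is NOT proved by any of this — R4 closes the conditional finite-𝕋⁴ rung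
`BalabanLadder.UV` only; NOT ℝ⁴ ∕ infinite volume ∕ OS.  No `def` ∕ `instance` ∕ `notation` ∕ `sorry`.  Sources (locators only): [LF-II] (1.80) p.384, (1.85) p.386, (1.89) p.387;
[III] (2.1) p.254, (2.18) p.257, p.244; [King1986] (3.10)–(3.11) p.656.
-/

noncomputable section

open scoped BigOperators
open _root_.Filter _root_.Topology

namespace Summit.QuantumFields.YangMills.BalabanUVNodes.N20KeyedRelWeightAtForgivingKey

open Literature.MathematicalPhysics.QuantumFieldTheory.Balaban1983to89 Literature.MathematicalPhysics.QuantumFieldTheory.Balaban1983to89.Node00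
open T4Continuum
open T4WeightBudget (RelWeightBound)
open YMDAG.UVSplit hiding SU
open Summit.QuantumFields.YangMills.BalabanUVNodes.SpineCanonicalWeights
open Summit.QuantumFields.YangMills.BalabanUVNodes.N20KeyedRelWeightLevels (sum_range_pow_age_le summable_ageMajorant_of_linearAge)
open Summit.QuantumFields.YangMills.BalabanUVNodes.N20KeyedRelWeightLevelsLive (survivalMajorant_lt_one_of_ageFloor)
open Summit.QuantumFields.YangMills.BalabanUVNodes.N20KeyedRelWeightAtKeyReading
open Summit.QuantumFields.YangMills.BalabanUVNodes.N20KeyedRelWeightOverCut (fst_eq_of_mem_classSet₁₃)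

variable {F : T4Family} {N : ℕ} [NeZero N]

/-! ## §1  The survival socket at ANY step-preserving dial (n20-d's level-cut bad reading): `W K ≤ V·r^{K₀+K−jcut K}∕(1−r)` and the design rule -/

section Survival

variable (θ : Stage13HParams F N) (hP : θ.Provisos₁₃CoPH F N) (K₀ : ℕ) (g₀ : ℕ → ℝ) (os : List (ULoop F)) (krR : KeyReading₁₃ N K₀) (jcut : ℕ → ℕ)
  (sh : ShellSplit₁₃CoPH N K₀) (hkr : ∀ (K : ℕ) (x : Σ K, SiteSeqKey F (K₀ + K)), x ∈ classSet₁₃ θ K₀ g₀ K → (krR F θ hP g₀ os K x).1 = K)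
  [DecidableEq (Σ K, SiteSeqKey F (K₀ + K))]
include hkr

/-- **★★ THE DIAL READING's FRACTION UNDER A PER-BIRTH-LEVEL SURVIVAL RATE AT THE COARSE CARRIERS** (any step-preserving dial; cut inside the window `jcut K ≤ K₀ + K`): per-stratum
survival domination `≤ V·r^{K₀+K−(j+1)} ·` (coarse class total) in both runs, `|t| ≤ 1`, `j < jcut K` ⇒ `W K ≤ V·r^{K₀+K−jcut K}∕(1−r)` (p610465 §3 at `a = b = V·r^{K₀+K−(j+1)}` + the age sum of
p606933 §1). [cite: Balaban1989LargeFieldII, (1.80) p.384, (1.89) p.387; King1986, (3.10)–(3.11) p.656 (bookkeeping)] -/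
theorem W_crOfRecord₁₃KAt_le_survival {r V : ℝ} (h0 : 0 ≤ r) (h1 : r < 1) (hV : 0 ≤ V) (K : ℕ) (hwin : jcut K ≤ K₀ + K)
    (hA : ∀ t : ℝ, |t| ≤ 1 → ∀ j < jcut K,
      ∑ u ∈ badClassK₁₃ θ K₀ g₀ (krR F θ hP g₀ os) (fun _ x => KeyOldLargeField ((fun _ : ℕ => j + 1) x.1) x.2) K t \
          badClassK₁₃ θ K₀ g₀ (krR F θ hP g₀ os) (fun _ x => KeyOldLargeField ((fun _ : ℕ => j) x.1) x.2) K t, weightAK₁₃ θ hP K₀ g₀ os (krR F θ hP g₀ os) K t u ≤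
        V * r ^ (K₀ + K - (j + 1)) * ∑ u ∈ classSetK₁₃ θ K₀ g₀ (krR F θ hP g₀ os) K, weightAK₁₃ θ hP K₀ g₀ os (krR F θ hP g₀ os) K t u)
    (hB : ∀ t : ℝ, |t| ≤ 1 → ∀ j < jcut K,
      ∑ u ∈ badClassK₁₃ θ K₀ g₀ (krR F θ hP g₀ os) (fun _ x => KeyOldLargeField ((fun _ : ℕ => j + 1) x.1) x.2) K t \
          badClassK₁₃ θ K₀ g₀ (krR F θ hP g₀ os) (fun _ x => KeyOldLargeField ((fun _ : ℕ => j) x.1) x.2) K t, weightBK₁₃ θ hP K₀ g₀ os (krR F θ hP g₀ os) K t u ≤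
        V * r ^ (K₀ + K - (j + 1)) * ∑ u ∈ classSetK₁₃ θ K₀ g₀ (krR F θ hP g₀ os) K, weightBK₁₃ θ hP K₀ g₀ os (krR F θ hP g₀ os) K t u) :
    (crOfRecord₁₃KAt K₀ krR (badKeyReadingOfCut₁₃ N K₀ jcut) sh F θ hP g₀ os).W K ≤ V * r ^ (K₀ + K - jcut K) / (1 - r) := by
  have hnn : ∀ j < jcut K, 0 ≤ V * r ^ (K₀ + K - (j + 1)) := fun j _ => mul_nonneg hV (pow_nonneg h0 _)
  refine (W_crOfRecord₁₃KAt_le_sum_levels θ hP K₀ g₀ os krR jcut sh hkr (a := fun j K => V * r ^ (K₀ + K - (j + 1)))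
    (b := fun j K => V * r ^ (K₀ + K - (j + 1))) K hnn hA hB).trans ?_
  simp only [max_self]
  rw [← Finset.mul_sum, mul_div_assoc]
  exact mul_le_mul_of_nonneg_left (sum_range_pow_age_le h0 h1 hwin) hV

/-- **★★ N20 AT A STEP-PRESERVING DIAL READING FROM A PER-BIRTH-LEVEL SURVIVAL RATE — THE DESIGN RULE**: survival rate `0 < r < 1`, entropy `V ≥ 0`, a MINIMAL AGE `a₀` with
`V·r^{a₀} < 1 − r`, a cut inside the window with age floor `≥ a₀` at every step and linear (`c·K ≤ K₀ + K − jcut K`), and the per-stratum survival domination at the COARSE carriers ⇒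
`RelWeightBound` AT `crOfRecord₁₃KAt K₀ kr (badKeyReadingOfCut₁₃ … jcut) sh F θ hP g₀ os` with its canonical `W` (p610465 §1 ★★; p606933∕p609064 arithmetic).  The survival letter is the
hypothesis — NE7b's body at the coarse key, NAMED OPEN. [cite: Balaban1989LargeFieldII, Thm 1 + (0.1) pp.355–356, (1.80) p.384, (1.89) p.387; King1986, (3.10)–(3.11) p.656 (bookkeeping)] -/
theorem relWeightBound_crOfRecord₁₃KAt_of_survival_ageFloor {r V c : ℝ} {a₀ : ℕ} (h0 : 0 < r) (h1 : r < 1) (hV : 0 ≤ V) (hc : 0 < c)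
    (hthr : V * r ^ a₀ < 1 - r) (hwin : ∀ K, jcut K ≤ K₀ + K) (hfloor : ∀ K, a₀ ≤ K₀ + K - jcut K)
    (hfrac : ∀ K : ℕ, c * K ≤ ((K₀ + K - jcut K : ℕ) : ℝ))
    (hA : ∀ (K : ℕ) (t : ℝ), |t| ≤ 1 → ∀ j < jcut K,
      ∑ u ∈ badClassK₁₃ θ K₀ g₀ (krR F θ hP g₀ os) (fun _ x => KeyOldLargeField ((fun _ : ℕ => j + 1) x.1) x.2) K t \
          badClassK₁₃ θ K₀ g₀ (krR F θ hP g₀ os) (fun _ x => KeyOldLargeField ((fun _ : ℕ => j) x.1) x.2) K t, weightAK₁₃ θ hP K₀ g₀ os (krR F θ hP g₀ os) K t u ≤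
        V * r ^ (K₀ + K - (j + 1)) * ∑ u ∈ classSetK₁₃ θ K₀ g₀ (krR F θ hP g₀ os) K, weightAK₁₃ θ hP K₀ g₀ os (krR F θ hP g₀ os) K t u)
    (hB : ∀ (K : ℕ) (t : ℝ), |t| ≤ 1 → ∀ j < jcut K,
      ∑ u ∈ badClassK₁₃ θ K₀ g₀ (krR F θ hP g₀ os) (fun _ x => KeyOldLargeField ((fun _ : ℕ => j + 1) x.1) x.2) K t \
          badClassK₁₃ θ K₀ g₀ (krR F θ hP g₀ os) (fun _ x => KeyOldLargeField ((fun _ : ℕ => j) x.1) x.2) K t, weightBK₁₃ θ hP K₀ g₀ os (krR F θ hP g₀ os) K t u ≤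
        V * r ^ (K₀ + K - (j + 1)) * ∑ u ∈ classSetK₁₃ θ K₀ g₀ (krR F θ hP g₀ os) K, weightBK₁₃ θ hP K₀ g₀ os (krR F θ hP g₀ os) K t u) :
    RelWeightBound (crOfRecord₁₃KAt K₀ krR (badKeyReadingOfCut₁₃ N K₀ jcut) sh F θ hP g₀ os).l₀ (crOfRecord₁₃KAt K₀ krR (badKeyReadingOfCut₁₃ N K₀ jcut) sh F θ hP g₀ os).T
      (crOfRecord₁₃KAt K₀ krR (badKeyReadingOfCut₁₃ N K₀ jcut) sh F θ hP g₀ os).A (crOfRecord₁₃KAt K₀ krR (badKeyReadingOfCut₁₃ N K₀ jcut) sh F θ hP g₀ os).B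
      (crOfRecord₁₃KAt K₀ krR (badKeyReadingOfCut₁₃ N K₀ jcut) sh F θ hP g₀ os).Bad (crOfRecord₁₃KAt K₀ krR (badKeyReadingOfCut₁₃ N K₀ jcut) sh F θ hP g₀ os).W := by
  have hle : ∀ K, (crOfRecord₁₃KAt K₀ krR (badKeyReadingOfCut₁₃ N K₀ jcut) sh F θ hP g₀ os).W K ≤ V * r ^ (K₀ + K - jcut K) / (1 - r) := fun K =>
    W_crOfRecord₁₃KAt_le_survival θ hP K₀ g₀ os krR jcut sh hkr h0.le h1 hV K (hwin K) (hA K) (hB K)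
  refine (relWeightBound_crOfRecord₁₃KAt_iff θ hP K₀ g₀ os krR (badKeyReadingOfCut₁₃ N K₀ jcut) sh).2 ⟨fun K => (hle K).trans_lt ?_, ?_⟩
  · exact survivalMajorant_lt_one_of_ageFloor K₀ jcut h0.le h1 hV hthr K (hfloor K)
  · exact Summable.of_nonneg_of_le (fun K => wInf_nonneg K) hle ((summable_ageMajorant_of_linearAge h0 h1 hV hc hfrac).div_const (1 - r))

end Survival

/-! ## §2  At the COMPONENT-FORGIVING reading: what the weight face books, why the wall does not transfer, the design rule there -/

section Forgive

variable (θ : Stage13HParams F N) (K₀ : ℕ) (g₀ : ℕ → ℝ)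

/-- The forgiving window keeps the step component: it is a STEP-PRESERVING dial on every class set. [cite: Balaban1988Convergent, (2.18) p.257 (bookkeeping)] -/
theorem forgiveKeyCompSigma_fst_eq (c : ℕ → ℕ) (K : ℕ) (x : Σ K, SiteSeqKey F (K₀ + K)) (hx : x ∈ classSet₁₃ θ K₀ g₀ K) : (forgiveKeyCompSigma F c x).1 = K := by
  rw [forgiveKeyCompSigma_fst]
  exact fst_eq_of_mem_classSet₁₃ θ K₀ g₀ K hx

/-- **A CUT AT OR BELOW THE FLOOR AT STEP `K` BOOKS NOTHING AT THE FORGIVING READING** (coarsening never creates bad keys; the forgiven key's entries below the floor are the whole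
lattice). [cite: Balaban1989LargeFieldII, (1.80) p.384 (bookkeeping)] -/
theorem badClassK₁₃_forgive_cut_eq_empty_at {c jcut : ℕ → ℕ} {K : ℕ} (h : jcut K ≤ c K) (t : ℝ) :
    badClassK₁₃ θ K₀ g₀ (fun _ x => forgiveKeyCompSigma F c x) (fun _ x => KeyOldLargeField (jcut x.1) x.2) K t = ∅ := by
  refine Finset.eq_empty_of_forall_notMem fun u hu => ?_
  rw [mem_badClassK₁₃_cut_iff θ K₀ g₀ _ (fun K x hx => forgiveKeyCompSigma_fst_eq θ K₀ g₀ c K x hx)] at hu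
  letI : ∀ Kc, DecidableEq (SiteSeqKey F Kc) := fun _ => Classical.decEq _
  obtain ⟨hu, hbad⟩ := hu
  unfold classSetK₁₃ at hu
  obtain ⟨⟨K', y⟩, hx, rfl⟩ := Finset.mem_image.1 hu
  obtain rfl : K' = K := fst_eq_of_mem_classSet₁₃ θ K₀ g₀ K hx
  have hbad' : KeyOldLargeField (jcut K') (forgiveKeyComp F (c K') y) := hbad
  obtain ⟨j, hcj, hj, -⟩ := keyOldLargeField_of_forgiveKeyComp F hbad'
  omega

/-- **★ A FLOOR-SATURATED HISTORY IS NEVER BOOKED AT THE FORGIVING READING** (floor `1 ≤ c K`): a class key whose floor-level small-field region is EMPTY (`Λ_{c K} = ∅`: every block of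
the floor lies in an old large-field region — the «every block large» extreme and anything it absorbs) reads to a key outside the coarse persistence class for EVERY cut (n20-d's
`not_keyOldLargeField_forgiveKeyCompSigma_of_floor_empty`).  Contrast: at the LEVEL window the same key is booked under every cut above the floor (`…AtKeyReading.windowKeySigma_mem_badClassK₁₃_of_levelOne`)
— so the extraction `le_weight_of_fraction_le` of the policy wall has no sub-class to ride on here. [cite: Balaban1989LargeFieldII, (1.85) p.386; Balaban1988Convergent, (2.18) p.257 (bookkeeping)] -/
theorem forgive_not_mem_badClassK₁₃_of_floor_saturated {c : ℕ → ℕ} (jcut : ℕ → ℕ) (K : ℕ) (hc : 1 ≤ c K) (t : ℝ) {x : Σ K, SiteSeqKey F (K₀ + K)}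
    (hx : x ∈ classSet₁₃ θ K₀ g₀ K) (hsat : x.2.2 (c K) = ∅) :
    forgiveKeyCompSigma F c x ∉ badClassK₁₃ θ K₀ g₀ (fun _ y => forgiveKeyCompSigma F c y) (fun _ y => KeyOldLargeField (jcut y.1) y.2) K t := by
  rw [mem_badClassK₁₃_cut_iff θ K₀ g₀ _ (fun K x hx => forgiveKeyCompSigma_fst_eq θ K₀ g₀ c K x hx)]
  rintro ⟨-, hbad⟩
  rcases x with ⟨K', y⟩
  obtain rfl : K' = K := fst_eq_of_mem_classSet₁₃ θ K₀ g₀ K hx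
  exact not_keyOldLargeField_forgiveKeyCompSigma_of_floor_empty F jcut ⟨K', y⟩ hc hsat hbad

/-- **★ WHAT THE WEIGHT FACE BOOKS AT THE FORGIVING READING: AN UN-ABSORBED BIRTH IN THE WINDOW** (floor `1 ≤ c K`): a class key of record reads to a BAD forgiven key under the cut
`jcut` iff at some level `c K < j ≤ jcut K` a point of its large-field region `Z_j` is NOT connected inside `Z_j` to the floor region `Z_{c K}` — a component of `Z_j` born in the
window and absorbed by no old structure (n20-d's `keyOldLargeField_forgiveKeyComp_iff` at the key). [cite: Balaban1989LargeFieldII, (1.85) p.386, (1.80) p.384 (bookkeeping)] -/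
theorem forgive_mem_badClassK₁₃_cut_iff_unabsorbed {c : ℕ → ℕ} (jcut : ℕ → ℕ) (K : ℕ) (hc : 1 ≤ c K) (t : ℝ) {x : Σ K, SiteSeqKey F (K₀ + K)}
    (hx : x ∈ classSet₁₃ θ K₀ g₀ K) :
    forgiveKeyCompSigma F c x ∈ badClassK₁₃ θ K₀ g₀ (fun _ y => forgiveKeyCompSigma F c y) (fun _ y => KeyOldLargeField (jcut y.1) y.2) K t ↔
      ∃ j, c K < j ∧ j ≤ jcut K ∧ ∃ z, z ∉ x.2.2 j ∧ ∀ z₀, z₀ ∉ x.2.2 j → z₀ ∉ x.2.2 (c K) → ¬ ConnIn SiteTouch (x.2.2 j)ᶜ z₀ z := by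
  rw [mem_badClassK₁₃_cut_iff θ K₀ g₀ _ (fun K x hx => forgiveKeyCompSigma_fst_eq θ K₀ g₀ c K x hx)]
  rcases x with ⟨K', y⟩
  obtain rfl : K' = K := fst_eq_of_mem_classSet₁₃ θ K₀ g₀ K hx
  rw [forgiveKeyCompSigma_mk]
  exact ⟨fun h => (keyOldLargeField_forgiveKeyComp_iff F hc (jcut K') y).1 h.2,
    fun h => ⟨kr_mem_classSetK₁₃ θ K₀ g₀ (fun _ y => forgiveKeyCompSigma F c y) hx, (keyOldLargeField_forgiveKeyComp_iff F hc (jcut K') y).2 h⟩⟩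

variable (hP : θ.Provisos₁₃CoPH F N) (os : List (ULoop F)) (cR : FloorReading₁₃ N) (jcut : ℕ → ℕ) (sh : ShellSplit₁₃CoPH N K₀)

/-- **THE CANONICAL FORM AT THE FORGIVING READING** (`…AtKeyReading` §1 ★★ at the dial `forgiveKeyCompSigma`): the face ⟺ `(∀ K, W K < 1) ∧ Summable W` on the reading's own `W`, hypothesis-free
at a tuple with core provisos. [cite: Balaban1989LargeFieldII, Thm 1 + (0.1) pp.355–356, (1.80) p.384; King1986, (3.10)–(3.11) p.656 (bookkeeping)] -/
theorem relWeightBound_crOfRecord₁₃KAt_forgive_iff :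
    RelWeightBound
        (crOfRecord₁₃KAt K₀ (fun F θ hP g₀ os _ x => forgiveKeyCompSigma F (cR F θ hP g₀ os) x) (badKeyReadingOfCut₁₃ N K₀ jcut) sh F θ hP g₀ os).l₀
        (crOfRecord₁₃KAt K₀ (fun F θ hP g₀ os _ x => forgiveKeyCompSigma F (cR F θ hP g₀ os) x) (badKeyReadingOfCut₁₃ N K₀ jcut) sh F θ hP g₀ os).T
        (crOfRecord₁₃KAt K₀ (fun F θ hP g₀ os _ x => forgiveKeyCompSigma F (cR F θ hP g₀ os) x) (badKeyReadingOfCut₁₃ N K₀ jcut) sh F θ hP g₀ os).A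
        (crOfRecord₁₃KAt K₀ (fun F θ hP g₀ os _ x => forgiveKeyCompSigma F (cR F θ hP g₀ os) x) (badKeyReadingOfCut₁₃ N K₀ jcut) sh F θ hP g₀ os).B
        (crOfRecord₁₃KAt K₀ (fun F θ hP g₀ os _ x => forgiveKeyCompSigma F (cR F θ hP g₀ os) x) (badKeyReadingOfCut₁₃ N K₀ jcut) sh F θ hP g₀ os).Bad
        (crOfRecord₁₃KAt K₀ (fun F θ hP g₀ os _ x => forgiveKeyCompSigma F (cR F θ hP g₀ os) x) (badKeyReadingOfCut₁₃ N K₀ jcut) sh F θ hP g₀ os).W ↔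
      (∀ K, (crOfRecord₁₃KAt K₀ (fun F θ hP g₀ os _ x => forgiveKeyCompSigma F (cR F θ hP g₀ os) x) (badKeyReadingOfCut₁₃ N K₀ jcut) sh F θ hP g₀ os).W K < 1) ∧
        Summable (crOfRecord₁₃KAt K₀ (fun F θ hP g₀ os _ x => forgiveKeyCompSigma F (cR F θ hP g₀ os) x) (badKeyReadingOfCut₁₃ N K₀ jcut) sh F θ hP g₀ os).W :=
  relWeightBound_crOfRecord₁₃KAt_iff θ hP K₀ g₀ os _ _ sh

variable [DecidableEq (Σ K, SiteSeqKey F (K₀ + K))]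

/-- **★★ THE DESIGN RULE AT THE FORGIVING READING** (floor reading `cR`, cut `jcut` inside the run with age floor `≥ a₀`, `V·r^{a₀} < 1 − r`, linear age floor): the per-birth-level
survival domination of the strata of the FORGIVEN persistence class («first un-absorbed birth in the window at level `j+1`») at the coarse carriers, in both runs ⇒ the N20 face AT
`crOfRecord₁₃KAt K₀ (forgiving dial at cR) (badKeyReadingOfCut₁₃ … jcut) sh F θ hP g₀ os`.  The strata below the floor are EMPTY (`badClassK₁₃_forgive_cut_eq_empty_at`), so the letter
speaks only for the window's levels; the floor-saturated histories are in NO stratum (`forgive_not_mem_badClassK₁₃_of_floor_saturated`) — the survival letter is not excluded by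
first-level saturation here.  It remains a HYPOTHESIS (NE7b at the window key, NAMED OPEN). [cite: Balaban1989LargeFieldII, Thm 1 + (0.1) pp.355–356, (1.80) p.384, (1.85) p.386, (1.89) p.387; Balaban1988Convergent, p.244; King1986, (3.10)–(3.11) p.656 (bookkeeping)] -/
theorem relWeightBound_crOfRecord₁₃KAt_forgive_of_survival_ageFloor {r V c : ℝ} {a₀ : ℕ} (h0 : 0 < r) (h1 : r < 1) (hV : 0 ≤ V) (hc : 0 < c)
    (hthr : V * r ^ a₀ < 1 - r) (hwin : ∀ K, jcut K ≤ K₀ + K) (hfloor : ∀ K, a₀ ≤ K₀ + K - jcut K)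
    (hfrac : ∀ K : ℕ, c * K ≤ ((K₀ + K - jcut K : ℕ) : ℝ))
    (hA : ∀ (K : ℕ) (t : ℝ), |t| ≤ 1 → ∀ j < jcut K,
      ∑ u ∈ badClassK₁₃ θ K₀ g₀ (fun _ x => forgiveKeyCompSigma F (cR F θ hP g₀ os) x) (fun _ x => KeyOldLargeField ((fun _ : ℕ => j + 1) x.1) x.2) K t \
          badClassK₁₃ θ K₀ g₀ (fun _ x => forgiveKeyCompSigma F (cR F θ hP g₀ os) x) (fun _ x => KeyOldLargeField ((fun _ : ℕ => j) x.1) x.2) K t,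
          weightAK₁₃ θ hP K₀ g₀ os (fun _ x => forgiveKeyCompSigma F (cR F θ hP g₀ os) x) K t u ≤
        V * r ^ (K₀ + K - (j + 1)) * ∑ u ∈ classSetK₁₃ θ K₀ g₀ (fun _ x => forgiveKeyCompSigma F (cR F θ hP g₀ os) x) K,
          weightAK₁₃ θ hP K₀ g₀ os (fun _ x => forgiveKeyCompSigma F (cR F θ hP g₀ os) x) K t u)
    (hB : ∀ (K : ℕ) (t : ℝ), |t| ≤ 1 → ∀ j < jcut K,
      ∑ u ∈ badClassK₁₃ θ K₀ g₀ (fun _ x => forgiveKeyCompSigma F (cR F θ hP g₀ os) x) (fun _ x => KeyOldLargeField ((fun _ : ℕ => j + 1) x.1) x.2) K t \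
          badClassK₁₃ θ K₀ g₀ (fun _ x => forgiveKeyCompSigma F (cR F θ hP g₀ os) x) (fun _ x => KeyOldLargeField ((fun _ : ℕ => j) x.1) x.2) K t,
          weightBK₁₃ θ hP K₀ g₀ os (fun _ x => forgiveKeyCompSigma F (cR F θ hP g₀ os) x) K t u ≤
        V * r ^ (K₀ + K - (j + 1)) * ∑ u ∈ classSetK₁₃ θ K₀ g₀ (fun _ x => forgiveKeyCompSigma F (cR F θ hP g₀ os) x) K,
          weightBK₁₃ θ hP K₀ g₀ os (fun _ x => forgiveKeyCompSigma F (cR F θ hP g₀ os) x) K t u) :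
    RelWeightBound
      (crOfRecord₁₃KAt K₀ (fun F θ hP g₀ os _ x => forgiveKeyCompSigma F (cR F θ hP g₀ os) x) (badKeyReadingOfCut₁₃ N K₀ jcut) sh F θ hP g₀ os).l₀
      (crOfRecord₁₃KAt K₀ (fun F θ hP g₀ os _ x => forgiveKeyCompSigma F (cR F θ hP g₀ os) x) (badKeyReadingOfCut₁₃ N K₀ jcut) sh F θ hP g₀ os).T
      (crOfRecord₁₃KAt K₀ (fun F θ hP g₀ os _ x => forgiveKeyCompSigma F (cR F θ hP g₀ os) x) (badKeyReadingOfCut₁₃ N K₀ jcut) sh F θ hP g₀ os).A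
      (crOfRecord₁₃KAt K₀ (fun F θ hP g₀ os _ x => forgiveKeyCompSigma F (cR F θ hP g₀ os) x) (badKeyReadingOfCut₁₃ N K₀ jcut) sh F θ hP g₀ os).B
      (crOfRecord₁₃KAt K₀ (fun F θ hP g₀ os _ x => forgiveKeyCompSigma F (cR F θ hP g₀ os) x) (badKeyReadingOfCut₁₃ N K₀ jcut) sh F θ hP g₀ os).Bad
      (crOfRecord₁₃KAt K₀ (fun F θ hP g₀ os _ x => forgiveKeyCompSigma F (cR F θ hP g₀ os) x) (badKeyReadingOfCut₁₃ N K₀ jcut) sh F θ hP g₀ os).W :=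
  relWeightBound_crOfRecord₁₃KAt_of_survival_ageFloor θ hP K₀ g₀ os _ jcut sh (fun K x hx => forgiveKeyCompSigma_fst_eq θ K₀ g₀ _ K x hx)
    h0 h1 hV hc hthr hwin hfloor hfrac hA hB

end Forgive


end Summit.QuantumFields.YangMills.BalabanUVNodes.N20KeyedRelWeightAtForgivingKey

end
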